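import Mathlib.Geometry.Manifold.Instances.Sphere
import Mathlib.Geometry.Manifold.MFDeriv.NormedSpace
import Mathlib.Analysis.InnerProductSpace.Calculus
import Mathlib.Analysis.SpecialFunctions.Sqrt
import HarnessLib

/-!
# Spherical caps by gnomonic projection: the cap map `ℝⁿ⁺¹ → Sⁿ⁺¹` and its inverse chart
(topic `Geometry/Riemannian`)

Infrastructure for the disc case of the named fact
`Literature.Geometry.Riemannian.Sweeney2026_pscMeanConvex` (Sweeney 2026, Prop. 1.2: compact
contractible manifolds with boundary carry metrics of positive scalar curvature with mean-convex
boundary), file `MeanConvexContractibleDisc.lean`: the closed ball `𝔻ⁿ⁺¹` is mapped onto a closed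
spherical cap of the round sphere `Sⁿ⁺¹` smaller than a hemisphere, whose boundary is a geodesic
sphere of positive mean curvature — the `0`-handle (geodesic ball) base case of
Lawson–Michelsohn's construction (Invent. Math. 77 (1984), Thm. 1) quoted by Sweeney.

Everything here is elementary and PROVED (no named facts). For a unit vector `v` of an inner
product space `V` of dimension `n + 2` (a point of Mathlib's manifold `sphere (0 : V) 1`, charts
`𝓡 (n + 1)`):

* `capFrame v`, `capEmb v`, `capProj v` — Mathlib's isometry `v^⊥ ≃ ℝⁿ⁺¹`
  (`OrthonormalBasis.fromOrthogonalSpanSingleton`, the one behind `stereographic'`), the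
  resulting isometric embedding `e : ℝⁿ⁺¹ → V` onto `v^⊥` and its left inverse (orthogonal
  projection followed by the frame): `proj ∘ e = id`, `e (proj p) = p - ⟪v, p⟫ v`.
* `capRadius x = √(‖x‖² + 1)`, `capLift v x = e x - v`, `capMapAmb v x = (e x - v)/√(‖x‖² + 1)` —
  **the gnomonic (central) projection** of the affine hyperplane `v^⊥ - v` (tangent to the sphere
  at `-v`) onto the open hemisphere about `-v`; smooth, unit-valued, with
  `⟪v, Φ x⟫ = -1/ρ(x) < 0`; its differential `capDeriv v x : a ↦ ρ⁻¹ e a - ρ⁻³⟪x, a⟫(e x - v)`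
  (`hasFDerivAt_capMapAmb`) is injective (`capDeriv_injective`).
* `capMap v : ℝⁿ⁺¹ → sphere (0 : V) 1` — the same as a smooth map into the manifold
  (`ContMDiff.codRestrict_sphere`), an immersion (`mfderiv_capMap_injective`), with
  `dι ∘ d(capMap) = capDeriv` (`mfderiv_coe_comp_mfderiv_capMap`).
* `capInv v p = -proj(p)/⟪v, p⟫` — **the gnomonic chart**, smooth where `⟪v, p⟫ ≠ 0`, inverting
  the cap map on the open hemisphere `⟪v, ·⟫ < 0` (`capInv_capMap`, `capMap_capInv`).

The unit ball `‖x‖ ≤ 1` is mapped onto the cap of angular radius `π/4` about `-v`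
(`ρ = √2` on `‖x‖ = 1`). Classical material (gnomonic projection; Lee 2018, Ch. 3 and Prop. 5.12
for the ambient description of spheres); the formalization follows Mathlib's
`Geometry/Manifold/Instances/Sphere.lean`.

## References

* P. Sweeney Jr., *Positive curvature conditions on contractible manifolds*, Math. Ann. (2026)
  = arXiv:2507.15719, Prop. 1.2. [Sweeney2026]
* H. B. Lawson, M.-L. Michelsohn, *Embedding and surrounding with positive mean curvature*,
  Invent. Math. 77 (1984) 399–419, Thm. 1. [LawsonMichelsohn1984]
* J. M. Lee, *Introduction to Riemannian Manifolds*, 2nd ed. (2018), Ch. 3, Prop. 5.12,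
  Example 8.25. [Lee2018]
-/

noncomputable section

open Bundle Set Function Metric Module Filter
open scoped Manifold ContDiff Topology RealInnerProductSpace

namespace Literature.Geometry.Riemannian

variable {V : Type*} [NormedAddCommGroup V] [InnerProductSpace ℝ V] {n : ℕ}

/-- Local notation: the parameter space `ℝⁿ⁺¹` of the cap. -/
local notation "𝔼" => EuclideanSpace ℝ (Fin (n + 1))

section Frame

variable [Fact (finrank ℝ V = n + 1 + 1)] (v : sphere (0 : V) 1)

/-- The linear isometry `v^⊥ ≃ ℝⁿ⁺¹` chosen by Mathlib for the stereographic chart from `v`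
(`OrthonormalBasis.fromOrthogonalSpanSingleton`). [folklore] -/
def capFrame : (ℝ ∙ (v : V))ᗮ ≃ₗᵢ[ℝ] 𝔼 :=
  (OrthonormalBasis.fromOrthogonalSpanSingleton (𝕜 := ℝ) (n + 1)
    (ne_zero_of_mem_unit_sphere v)).repr

/-- The isometric linear embedding `e : ℝⁿ⁺¹ → V` onto the hyperplane `v^⊥`. [folklore] -/
def capEmb : 𝔼 →L[ℝ] V :=
  (ℝ ∙ (v : V))ᗮ.subtypeL ∘L
    (capFrame (n := n) v).symm.toContinuousLinearEquiv.toContinuousLinearMap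

/-- Its left inverse `V → ℝⁿ⁺¹`: orthogonal projection onto `v^⊥` followed by the frame. [folklore] -/
def capProj : V →L[ℝ] 𝔼 :=
  (capFrame (n := n) v).toContinuousLinearEquiv.toContinuousLinearMap ∘L
    (ℝ ∙ (v : V))ᗮ.orthogonalProjectionOnto

/-- `e a` is the frame vector `U⁻¹ a` of `v^⊥`, read in `V`. [folklore] -/
theorem capEmb_apply (a : 𝔼) : capEmb v a = ((capFrame v).symm a : V) := rfl

/-- `proj p` is the frame applied to the orthogonal projection of `p` onto `v^⊥`. [folklore] -/
theorem capProj_apply (p : V) :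
    capProj (n := n) v p = capFrame v ((ℝ ∙ (v : V))ᗮ.orthogonalProjectionOnto p) := rfl

omit [Fact (finrank ℝ V = n + 1 + 1)] in
/-- `⟪v, v⟫ = 1` for a point `v` of the unit sphere. [folklore] -/
theorem real_inner_self_coe_unitSphere : ⟪(v : V), v⟫ = 1 := by
  rw [real_inner_self_eq_norm_sq, norm_eq_of_mem_sphere v, one_pow]

/-- `e(ℝⁿ⁺¹) ⊥ v`. [folklore] -/
theorem inner_pole_capEmb (a : 𝔼) : ⟪(v : V), capEmb v a⟫ = 0 :=
  Submodule.mem_orthogonal_singleton_iff_inner_right.1 ((capFrame v).symm a).2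

/-- `e(ℝⁿ⁺¹) ⊥ v` (symmetric form). [folklore] -/
theorem inner_capEmb_pole (a : 𝔼) : ⟪capEmb v a, (v : V)⟫ = 0 := by
  rw [real_inner_comm, inner_pole_capEmb]

/-- `e` is isometric. [folklore] -/
theorem inner_capEmb_capEmb (a b : 𝔼) : ⟪capEmb v a, capEmb v b⟫ = ⟪a, b⟫ := by
  rw [capEmb_apply, capEmb_apply, ← Submodule.coe_inner, LinearIsometryEquiv.inner_map_map]

/-- `e` preserves norms. [folklore] -/
theorem norm_capEmb (a : 𝔼) : ‖capEmb v a‖ = ‖a‖ := by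
  rw [capEmb_apply, ← (capFrame v).symm.norm_map a]
  rfl

/-- `proj ∘ e = id`. [folklore] -/
@[simp] theorem capProj_capEmb (a : 𝔼) : capProj v (capEmb v a) = a := by
  rw [capProj_apply, capEmb_apply, Submodule.orthogonalProjectionOnto_mem_subspace_eq_self,
    LinearIsometryEquiv.apply_symm_apply]

/-- `e ∘ proj` is the orthogonal projection onto `v^⊥`: `e (proj p) = p - ⟪v, p⟫ v`. [folklore] -/
theorem capEmb_capProj (p : V) :
    capEmb v (capProj (n := n) v p) = p - ⟪(v : V), p⟫ • (v : V) := by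
  rw [capProj_apply, capEmb_apply, LinearIsometryEquiv.symm_apply_apply,
    ← Submodule.starProjection_apply, eq_sub_iff_add_eq, add_comm,
    ← Submodule.starProjection_unit_singleton ℝ (norm_eq_of_mem_sphere v),
    Submodule.starProjection_add_starProjection_orthogonal]

/-- `proj v = 0`. [folklore] -/
@[simp] theorem capProj_pole : capProj (n := n) v (v : V) = 0 := by
  rw [capProj_apply, Submodule.orthogonalProjectionOnto_orthogonalComplement_singleton_eq_zero,
    map_zero]

end Frame

/-! ### The gnomonic cap map `ℝⁿ⁺¹ → Sⁿ⁺¹` -/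

section CapMap

variable [Fact (finrank ℝ V = n + 1 + 1)] (v : sphere (0 : V) 1)

omit [Fact (finrank ℝ V = n + 1 + 1)] in
/-- The length `ρ(x) = √(‖x‖² + 1)` of the point `e x - v` of the hyperplane `v^⊥ - v`. [folklore] -/
def capRadius (x : 𝔼) : ℝ := √(‖x‖ ^ 2 + 1)

/-- The point `e x - v` of the affine hyperplane `v^⊥ - v` (tangent to the sphere at `-v`). [folklore] -/
def capLift (x : 𝔼) : V := capEmb v x - (v : V)

/-- **The gnomonic (central) projection** of the hyperplane `v^⊥ - v` to the unit sphere, as a map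
into `V`: `x ↦ (e x - v) / ‖e x - v‖`; its image is the open hemisphere centred at `-v`, and the unit
ball is mapped onto the closed spherical cap of angular radius `π / 4` about `-v`. [folklore] -/
def capMapAmb (x : 𝔼) : V := (capRadius (n := n) x)⁻¹ • capLift v x

omit [Fact (finrank ℝ V = n + 1 + 1)] in
/-- `ρ(x)² = ‖x‖² + 1`. [folklore] -/
theorem capRadius_sq (x : 𝔼) : capRadius (n := n) x ^ 2 = ‖x‖ ^ 2 + 1 :=
  Real.sq_sqrt (by positivity)

omit [Fact (finrank ℝ V = n + 1 + 1)] in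
/-- `ρ(x) > 0`. [folklore] -/
theorem capRadius_pos (x : 𝔼) : 0 < capRadius (n := n) x :=
  Real.sqrt_pos.2 (by positivity)

omit [Fact (finrank ℝ V = n + 1 + 1)] in
/-- `ρ(x) ≥ 1`. [folklore] -/
theorem one_le_capRadius (x : 𝔼) : 1 ≤ capRadius (n := n) x := by
  rw [capRadius, Real.one_le_sqrt]
  nlinarith [sq_nonneg ‖x‖]

/-- `‖e x - v‖² = ‖x‖² + 1` (Pythagoras, `e x ⊥ v`). [folklore] -/
theorem norm_capLift_sq (x : 𝔼) : ‖capLift v x‖ ^ 2 = ‖x‖ ^ 2 + 1 := by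
  rw [capLift, @norm_sub_sq_real, norm_capEmb, inner_capEmb_pole, norm_eq_of_mem_sphere v]
  ring

/-- `‖e x - v‖ = ρ(x)`. [folklore] -/
theorem norm_capLift (x : 𝔼) : ‖capLift v x‖ = capRadius (n := n) x := by
  rw [capRadius, ← norm_capLift_sq v x, Real.sqrt_sq (norm_nonneg _)]

/-- `⟪v, e x - v⟫ = -1`. [folklore] -/
theorem inner_pole_capLift (x : 𝔼) : ⟪(v : V), capLift v x⟫ = -1 := by
  rw [capLift, inner_sub_right, inner_pole_capEmb, real_inner_self_coe_unitSphere, zero_sub]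

/-- `⟪e x - v, e a⟫ = ⟪x, a⟫`. [folklore] -/
theorem inner_capLift_capEmb (x a : 𝔼) : ⟪capLift v x, capEmb v a⟫ = ⟪x, a⟫ := by
  rw [capLift, inner_sub_left, inner_capEmb_capEmb, inner_pole_capEmb, sub_zero]

/-- The gnomonic projection takes values in the unit sphere. [folklore] -/
theorem norm_capMapAmb (x : 𝔼) : ‖capMapAmb v x‖ = 1 := by
  rw [capMapAmb, norm_smul, norm_inv, Real.norm_of_nonneg (capRadius_pos x).le, norm_capLift,
    inv_mul_cancel₀ (capRadius_pos x).ne']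

/-- The gnomonic projection takes values in Mathlib's `sphere (0 : V) 1`. [folklore] -/
theorem capMapAmb_mem (x : 𝔼) : capMapAmb v x ∈ sphere (0 : V) 1 := by
  rw [mem_sphere_zero_iff_norm, norm_capMapAmb]

/-- The height of the image point: `⟪v, Φ(x)⟫ = -1/ρ(x) < 0` (open hemisphere about `-v`). [folklore] -/
theorem inner_pole_capMapAmb (x : 𝔼) : ⟪(v : V), capMapAmb v x⟫ = -(capRadius (n := n) x)⁻¹ := by
  rw [capMapAmb, inner_smul_right, inner_pole_capLift, mul_neg_one]

/-- The gnomonic projection takes values in the open hemisphere `⟪v, ·⟫ < 0` about `-v`. [folklore] -/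
theorem inner_pole_capMapAmb_neg (x : 𝔼) : ⟪(v : V), capMapAmb v x⟫ < 0 := by
  rw [inner_pole_capMapAmb]
  exact neg_neg_of_pos (inv_pos.2 (capRadius_pos x))

omit [Fact (finrank ℝ V = n + 1 + 1)] in
/-- `ρ` is smooth (square root of a positive smooth function). [folklore] -/
theorem contDiff_capRadius : ContDiff ℝ ∞ (capRadius (n := n)) :=
  ((contDiff_norm_sq ℝ).add contDiff_const).sqrt fun x ↦ by positivity

/-- `x ↦ e x - v` is smooth (affine). [folklore] -/
theorem contDiff_capLift : ContDiff ℝ ∞ (capLift (n := n) v) :=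
  (capEmb (n := n) v).contDiff.sub contDiff_const

/-- The gnomonic projection is smooth. [folklore] -/
theorem contDiff_capMapAmb : ContDiff ℝ ∞ (capMapAmb (n := n) v) :=
  (contDiff_capRadius.inv fun x ↦ (capRadius_pos x).ne').smul (contDiff_capLift v)

/-- The differential of the gnomonic projection at `x`:
`a ↦ ρ⁻¹ e a - ρ⁻³ ⟪x, a⟫ (e x - v)`. [folklore] -/
def capDeriv (x : 𝔼) : 𝔼 →L[ℝ] V :=
  (capRadius (n := n) x)⁻¹ • capEmb v +
    (-((capRadius (n := n) x)⁻¹ ^ 3) • innerSL ℝ x).smulRight (capLift v x)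

/-- Pointwise formula for `capDeriv`: `a ↦ ρ⁻¹ e a - ρ⁻³ ⟪x, a⟫ (e x - v)`. [folklore] -/
theorem capDeriv_apply (x a : 𝔼) : capDeriv v x a =
    (capRadius (n := n) x)⁻¹ • capEmb v a - ((capRadius (n := n) x)⁻¹ ^ 3 * ⟪x, a⟫) • capLift v x := by
  simp only [capDeriv, add_apply, smul_apply, ContinuousLinearMap.smulRight_apply, neg_apply,
    innerSL_apply_apply, smul_eq_mul, neg_smul]
  abel

/-- The gnomonic projection has differential `capDeriv`. [folklore] -/
theorem hasFDerivAt_capMapAmb (x : 𝔼) : HasFDerivAt (capMapAmb (n := n) v) (capDeriv v x) x := by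
  have hq : 0 < ‖x‖ ^ 2 + 1 := by positivity
  have h1 : HasFDerivAt (fun x : 𝔼 ↦ ‖x‖ ^ 2 + 1) (2 • innerSL ℝ x) x :=
    (hasStrictFDerivAt_norm_sq x).hasFDerivAt.add_const 1
  have h2 : HasDerivAt (fun q : ℝ ↦ (√q)⁻¹) (-(1 / (2 * √(‖x‖ ^ 2 + 1))) / √(‖x‖ ^ 2 + 1) ^ 2)
      (‖x‖ ^ 2 + 1) :=
    (Real.hasDerivAt_sqrt hq.ne').inv (Real.sqrt_pos.2 hq).ne'
  have h3 := h2.comp_hasFDerivAt x h1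
  have h4 : HasFDerivAt (capLift (n := n) v) (capEmb v) x :=
    (capEmb v).hasFDerivAt.sub_const (v : V)
  have h5 : HasFDerivAt (capMapAmb (n := n) v) ((capRadius (n := n) x)⁻¹ • capEmb v +
      ((-(1 / (2 * √(‖x‖ ^ 2 + 1))) / √(‖x‖ ^ 2 + 1) ^ 2) • (2 • innerSL ℝ x)).smulRight
        (capLift v x)) x := h3.smul h4
  refine h5.congr_fderiv ?_
  ext a
  simp only [capDeriv, capRadius, add_apply, smul_apply, ContinuousLinearMap.smulRight_apply,
    innerSL_apply_apply, smul_eq_mul, nsmul_eq_mul, Nat.cast_ofNat]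
  congr 1
  congr 1
  have hρ : 0 < √(‖x‖ ^ 2 + 1) := Real.sqrt_pos.2 hq
  field_simp

/-- The gnomonic projection is differentiable. [folklore] -/
theorem differentiableAt_capMapAmb (x : 𝔼) : DifferentiableAt ℝ (capMapAmb (n := n) v) x :=
  (hasFDerivAt_capMapAmb v x).differentiableAt

/-- `fderiv` of the gnomonic projection is `capDeriv`. [folklore] -/
theorem fderiv_capMapAmb (x : 𝔼) : fderiv ℝ (capMapAmb (n := n) v) x = capDeriv v x :=
  (hasFDerivAt_capMapAmb v x).fderiv

/-- `⟪v, DΦₓ(a)⟫ = ρ⁻³ ⟪x, a⟫`. [folklore] -/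
theorem inner_pole_capDeriv (x a : 𝔼) :
    ⟪(v : V), capDeriv v x a⟫ = (capRadius (n := n) x)⁻¹ ^ 3 * ⟪x, a⟫ := by
  rw [capDeriv_apply, inner_sub_right, inner_smul_right, inner_smul_right, inner_pole_capEmb,
    inner_pole_capLift]
  ring

/-- The differential of the gnomonic projection is injective. [folklore] -/
theorem capDeriv_injective (x : 𝔼) : Injective (capDeriv (n := n) v x) := by
  refine (injective_iff_map_eq_zero (capDeriv (n := n) v x)).2 fun a ha ↦ ?_
  have h1 : ⟪x, a⟫ = 0 := by
    have h := inner_pole_capDeriv v x a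
    rw [ha, inner_zero_right] at h
    exact (mul_eq_zero.1 h.symm).resolve_left
      (pow_ne_zero 3 (inv_ne_zero (capRadius_pos x).ne'))
  rw [capDeriv_apply, h1, mul_zero, zero_smul, sub_zero, smul_eq_zero] at ha
  rcases ha with ha | ha
  · exact absurd ha (inv_ne_zero (capRadius_pos x).ne')
  · rw [← norm_eq_zero, ← norm_capEmb v a, ha, norm_zero]

/-- **The cap map** `ℝⁿ⁺¹ → Sⁿ⁺¹`: the gnomonic projection as a map into Mathlib's manifold
`sphere (0 : V) 1`. [folklore] -/
def capMap : 𝔼 → sphere (0 : V) 1 :=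
  Set.codRestrict (capMapAmb v) (sphere (0 : V) 1) (capMapAmb_mem v)

/-- The cap map followed by the inclusion of the sphere is the gnomonic projection. [folklore] -/
@[simp] theorem coe_capMap (x : 𝔼) : (capMap v x : V) = capMapAmb v x := rfl

/-- The cap map is smooth (Mathlib's `ContMDiff.codRestrict_sphere`). [folklore] -/
theorem contMDiff_capMap : ContMDiff 𝓘(ℝ, 𝔼) (𝓡 (n + 1)) ∞ (capMap (n := n) v) :=
  (contDiff_capMapAmb v).contMDiff.codRestrict_sphere (capMapAmb_mem v)

/-- The cap map is differentiable (as a map into the manifold `Sⁿ⁺¹`). [folklore] -/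
theorem mdifferentiableAt_capMap (x : 𝔼) :
    MDifferentiableAt 𝓘(ℝ, 𝔼) (𝓡 (n + 1)) (capMap (n := n) v) x :=
  (contMDiff_capMap v x).mdifferentiableAt (by simp)

/-- The differential of the cap map followed by that of the inclusion `Sⁿ⁺¹ ↪ V` is the
differential of the gnomonic projection. [folklore] -/
theorem mfderiv_coe_comp_mfderiv_capMap (x : 𝔼) :
    (mfderiv (𝓡 (n + 1)) 𝓘(ℝ, V) (Subtype.val : sphere (0 : V) 1 → V) (capMap v x)).comp
        (mfderiv 𝓘(ℝ, 𝔼) (𝓡 (n + 1)) (capMap (n := n) v) x) = capDeriv v x := by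
  have h1 : HasMFDerivAt 𝓘(ℝ, 𝔼) 𝓘(ℝ, V) ((Subtype.val : sphere (0 : V) 1 → V) ∘ capMap v) x
      ((mfderiv (𝓡 (n + 1)) 𝓘(ℝ, V) (Subtype.val : sphere (0 : V) 1 → V) (capMap v x)).comp
        (mfderiv 𝓘(ℝ, 𝔼) (𝓡 (n + 1)) (capMap (n := n) v) x)) :=
    ((contMDiff_coe_sphere (capMap v x)).mdifferentiableAt one_ne_zero).hasMFDerivAt.comp x
      (mdifferentiableAt_capMap v x).hasMFDerivAt
  have h2 := (hasFDerivAt_capMapAmb (n := n) v x).hasMFDerivAt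
  exact h1.mfderiv.symm.trans h2.mfderiv

/-- Pointwise form of `mfderiv_coe_comp_mfderiv_capMap`: `dι (dΦ a) = capDeriv a`. [folklore] -/
theorem mfderiv_coe_mfderiv_capMap (x a : 𝔼) :
    mfderiv (𝓡 (n + 1)) 𝓘(ℝ, V) (Subtype.val : sphere (0 : V) 1 → V) (capMap v x)
      (mfderiv 𝓘(ℝ, 𝔼) (𝓡 (n + 1)) (capMap (n := n) v) x a) = capDeriv v x a := by
  rw [← mfderiv_coe_comp_mfderiv_capMap v x]
  rfl

/-- The same with Mathlib's vector-valued differential `mvfderiv` of the inclusion. [folklore] -/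
theorem mvfderiv_coe_mfderiv_capMap (x a : 𝔼) :
    mvfderiv (𝓡 (n + 1)) (Subtype.val : sphere (0 : V) 1 → V) (capMap v x)
      (mfderiv 𝓘(ℝ, 𝔼) (𝓡 (n + 1)) (capMap (n := n) v) x a) = capDeriv v x a :=
  mfderiv_coe_mfderiv_capMap v x a

/-- The cap map is an immersion: its differentials are injective. [folklore] -/
theorem mfderiv_capMap_injective (x : 𝔼) :
    Injective (mfderiv 𝓘(ℝ, 𝔼) (𝓡 (n + 1)) (capMap (n := n) v) x) := fun a b hab ↦
  capDeriv_injective v x (by rw [← mfderiv_coe_mfderiv_capMap, ← mfderiv_coe_mfderiv_capMap, hab])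

/-! ### The gnomonic chart (inverse of the cap map on the open hemisphere) -/

/-- The inverse of the cap map on the open hemisphere `{⟪v, ·⟫ < 0}`: `p ↦ -proj(p) / ⟪v, p⟫`. [folklore] -/
def capInv (p : V) : 𝔼 := (-⟪(v : V), p⟫)⁻¹ • capProj (n := n) v p

/-- The gnomonic chart inverts the gnomonic projection: `capInv (Φ x) = x`. [folklore] -/
theorem capInv_capMapAmb (x : 𝔼) : capInv (n := n) v (capMapAmb (n := n) v x) = x := by
  rw [capInv, inner_pole_capMapAmb, neg_neg, inv_inv, capMapAmb, map_smul, capLift, map_sub,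
    capProj_capEmb, capProj_pole, sub_zero, smul_smul, mul_inv_cancel₀ (capRadius_pos x).ne',
    one_smul]

/-- The gnomonic chart inverts the cap map: `capInv (Φ x) = x`. [folklore] -/
theorem capInv_capMap (x : 𝔼) : capInv (n := n) v (capMap (n := n) v x : V) = x :=
  capInv_capMapAmb v x

/-- The gnomonic chart is smooth off the hyperplane `⟪v, ·⟫ = 0`. [folklore] -/
theorem contDiffAt_capInv {p : V} (hp : ⟪(v : V), p⟫ ≠ 0) : ContDiffAt ℝ ∞ (capInv (n := n) v) p := by
  have h1 : ContDiffAt ℝ ∞ (fun p : V ↦ (-⟪(v : V), p⟫)⁻¹) p :=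
    ((innerSL ℝ (v : V)).contDiff.neg.contDiffAt).inv (neg_ne_zero.2 hp)
  exact h1.smul (capProj (n := n) v).contDiff.contDiffAt

/-- `e (capInv p) - v = -p/⟪v, p⟫` off the hyperplane `⟪v, ·⟫ = 0`. [folklore] -/
theorem capLift_capInv {p : V} (hp : ⟪(v : V), p⟫ ≠ 0) :
    capLift v (capInv (n := n) v p) = (-⟪(v : V), p⟫)⁻¹ • p := by
  have h1 : (-⟪(v : V), p⟫)⁻¹ * ⟪(v : V), p⟫ = -1 := by
    rw [inv_neg, neg_mul, inv_mul_cancel₀ hp]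
  rw [capLift, capInv, map_smul, capEmb_capProj, smul_sub, smul_smul, h1, neg_one_smul,
    sub_neg_eq_add, add_sub_cancel_right]

/-- On the open lower unit hemisphere the gnomonic projection inverts the gnomonic chart. [folklore] -/
theorem capMapAmb_capInv {p : V} (hp1 : ‖p‖ = 1) (hp : ⟪(v : V), p⟫ < 0) :
    capMapAmb v (capInv (n := n) v p) = p := by
  have hs : 0 < (-⟪(v : V), p⟫)⁻¹ := inv_pos.2 (neg_pos.2 hp)
  rw [capMapAmb, ← norm_capLift v, capLift_capInv v hp.ne, norm_smul, hp1, mul_one,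
    Real.norm_of_nonneg hs.le, smul_smul, inv_mul_cancel₀ hs.ne', one_smul]

/-- On the open hemisphere about `-v` the gnomonic chart inverts the cap map. [folklore] -/
theorem capMap_capInv {y : sphere (0 : V) 1} (hy : ⟪(v : V), y⟫ < 0) :
    capMap v (capInv (n := n) v y) = y :=
  Subtype.ext (capMapAmb_capInv v (norm_eq_of_mem_sphere y) hy)

/-- Every point of the open hemisphere about `-v` is in the image of the cap map. [folklore] -/
theorem exists_capMap_eq {y : sphere (0 : V) 1} (hy : ⟪(v : V), y⟫ < 0) :
    ∃ x : 𝔼, capMap (n := n) v x = y :=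
  ⟨_, capMap_capInv v hy⟩

end CapMap

end Literature.Geometry.Riemannian

end
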